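import Literature.MathematicalPhysics.QuantumFieldTheory.Balaban1983to89.B12Lemma4Space
import Literature.MathematicalPhysics.QuantumFieldTheory.Balaban1983to89.B12Eq117Concrete
import Literature.MathematicalPhysics.QuantumFieldTheory.Balaban1983to89.B12RegularSpaces111Unitary
import Literature.MathematicalPhysics.QuantumFieldTheory.Balaban1983to89.B12RegularSpaces111SpecialUnitary

/-!
# `Balaban1983to89.B12Lemma4Models` — T. Bałaban, *Renormalization group approach to lattice gauge field theories. I*,
Commun. Math. Phys. **109** (1987) 249–301 [Balaban1987RG1]: **MODEL INSTANCES `U(N)` and `SU(N)` of the concrete Lemma 4 (3.53) /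
(1.17) membership theorems** (`B12Lemma4Space.ofBackground_mem_space'_lemma4`, `B12Eq117Concrete.ofBackground_mem_space'_of_prop9Shape`):
their three model hypotheses — `exp iξ·` maps `𝔤ᶜ` into `Gᶜ`, `𝔤ᶜ` is `Ad(Gᶜ)`-stable, and the projection `π` of the current (1.8) takes
values in `𝔤ᶜ` — DISCHARGED in the `U(N)`-type model `B12RegularSpaces111Unitary.unitaryModel` (`Gᶜ = 𝔸ˣ`, `𝔤ᶜ = 𝔸`: vacuous, any `π`) and
in the `SU(N)` model `B12RegularSpaces111SpecialUnitary.suModel` (`Gᶜ = SL(N, ℂ)`, `𝔤ᶜ = 𝔰𝔩(N, ℂ)`), the latter WITH the printed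
projection `π` onto `𝔤ᶜ` made concrete: the traceless part `X ↦ X − (tr X / N)·1` (`slProj`).

HONEST FRAMING (cell `lit-balaban`, verbatim): statement-level skeleton of published theorems with citation tags; proofs where landed; nothing here is a claim about the Yang–Mills mass gap.

PDF held: `paper:balaban1987-cmp109-rg-i-small-field` (journal page = PDF page + 248); pp. 252, 261, 263, 280 re-read as images from the
renders `b2b-balaban-ref1/pages/1987-cmp109-rg-I-small-field/…-p004/p013/p015/p032-x2.png` by this unit and its predecessors.

THE PRINT, verbatim.  p. 252: *«Let us recall that G is semisimple, so we can consider it as a Lie subgroup of a group of complex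
unitary matrices, for example G ⊂ U(N)»*, *«𝐔 = U′U, where U ∈ G and U′ = exp iA′, A′ ∈ 𝔤ᶜ, 𝔤ᶜ is the complexification of the real
Lie algebra 𝔤»*.  p. 261: *«J_j = D^{ξ*}_{U_j} ξ⁻² π Im ∂U_j, (1.8) where π denotes the projection in the space of all complex
N × N-matrices onto the algebra 𝔤ᶜ, and Im U = (1/2i)(U − U⁻¹).»*  p. 263: *«… such that 𝐉 = D^{ξ*}_𝐔 ξ⁻²π Im ∂𝐔 satisfies the bound
|𝐉| < α₀′ … Then the pairs (𝐔, 𝐉) belong to U^c_j(X, α₀, α₁).»*  p. 280, Lemma 4: *«(U_j(□₀, exp i(τB + B′)), J_j(□₀, exp i(τB + B′)))|_X ∈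
U^c_j(X, α₀, α₁) (3.53)»*.

THE TYPING (carriers of record; one new definition).  `slProj N : M_N(ℂ) →ₗ[ℂ] M_N(ℂ)`, `slProj N X = X − (N⁻¹·tr X)·1` — for
`𝔤 = 𝔰𝔲(N)`, `𝔤ᶜ = 𝔰𝔩(N, ℂ)` (the model `suModel`, p. 252 «G is semisimple») this IS the print's «projection … onto the algebra 𝔤ᶜ» along
the scalars `ℂ·1` (`M_N(ℂ) = 𝔰𝔩(N, ℂ) ⊕ ℂ·1`; for `N = 0` everything is `0`): PROVED `trace_slProj` (values in `𝔰𝔩(N, ℂ)`),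
`slProj_of_trace_eq_zero` (identity on `𝔰𝔩(N, ℂ)`, hence idempotent), `slProj_conj` (commutes with `Ad(g)`, `g ∈ GL(N, ℂ)` — the
hypothesis `hπ` of `B12Eq18Current.current_gaugeU`).  Model hypotheses PROVED: `unitaryModel_heGc` / `unitaryModel_hgc_Gc` /
`unitaryModel_hπ` (vacuous), `suModel_heGc` (Liouville: `det e^{iξA} = e^{iξ tr A} = 1`, `B12RegularSpaces111SpecialUnitary.suModel_expI_mem_Gc`),
`suModel_hgc_Gc` (`tr(gXg⁻¹) = tr X`), `slProj_mem_suModel_gc`; and, since `slProj` commutes with `Ad(GL(N, ℂ))`, the gauge covariance of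
the current (1.8) / the intertwining (1.9)–(1.10) hypothesis-free in the `SU(N)` model (`current_gaugeU_su`, `ofBackground_gaugeU_su`).
COROLLARIES with those hypotheses discharged:
`ofBackground_mem_space'_lemma4_unitary` / `_su` (Lemma 4 for the printed pair with the concrete current), `gaugeU_ofBackground_mem_space'_lemma4_su`
(the same for the gauge transform `(exp iξ𝐊)^{u}`, `u` `SL(N, ℂ)`-valued — print's `U_j(□₀, ·) = (exp iξ𝐇_j(□₀, ·))^{u_j}` of (3.37)),
`ofBackground_mem_space'_of_prop9Shape_unitary` / `_su` (the (1.17) specialisation).  All remaining hypotheses are the by-reference inputs of the print listed in `B12Lemma4Space` /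
`B12Eq117Concrete` (bond/plaquette data (3.37), (3.41), (3.45), (3.50), the J-half, (iv), (1.17)).  No `Prop` placeholder, no new fact;
axioms standard.  Unit `lit-balaban-p07` (Phase-2 seat p07 gen 6; TAKING line HOME/STATUS.md 2026-08-21T07:03:00Z; rows B12.Lem4 /
B12.Eq1.17 / B12.Eq1.8, owners r09/r20), HOME `run/shared/lean/pub/lit-balaban/`.
-/

namespace Literature.MathematicalPhysics.QuantumFieldTheory.Balaban1983to89.B12Lemma4Models

open Literature.MathematicalPhysics.QuantumFieldTheory.Balaban1983to89
open Literature.MathematicalPhysics.QuantumFieldTheory.Balaban1983to89.B12RegularSpaces111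
open Literature.MathematicalPhysics.QuantumFieldTheory.Balaban1983to89.B12RegularSpaces111Unitary
open Literature.MathematicalPhysics.QuantumFieldTheory.Balaban1983to89.B12RegularSpaces111SpecialUnitary
open Literature.MathematicalPhysics.QuantumFieldTheory.Balaban1983to89.B12Lemma4Space
open Literature.MathematicalPhysics.QuantumFieldTheory.Balaban1983to89.B12Eq117Concrete

noncomputable section

/-! ## §1. The `U(N)`-type model: the three hypotheses are vacuous -/

section Unitary

variable {𝔸 : Type*} [NormedRing 𝔸] [NormedAlgebra ℂ 𝔸] [StarRing 𝔸]

/-- **`heGc` in the `U(N)`-type model**: `exp iξA ∈ Gᶜ = 𝔸ˣ` for every `A` (vacuous). [cite: Balaban1987RG1, p.252] -/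
theorem unitaryModel_heGc [CompleteSpace 𝔸] (ξ : ℝ) : ∀ A ∈ (unitaryModel 𝔸).gc, expI ξ A ∈ (unitaryModel 𝔸).Gc :=
  fun _ _ => mem_unitaryModel_Gc _

/-- **`hgc` in the `U(N)`-type model**: `𝔤ᶜ = 𝔸` is `Ad(Gᶜ)`-stable (vacuous). [cite: Balaban1987RG1, (1.10) p.262] -/
theorem unitaryModel_hgc_Gc : ∀ g ∈ (unitaryModel 𝔸).Gc, ∀ X ∈ (unitaryModel 𝔸).gc, B9Eq39Adjoint.R g X ∈ (unitaryModel 𝔸).gc :=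
  fun _ _ _ _ => mem_unitaryModel_gc _

/-- **`hπ` in the `U(N)`-type model**: any `π` takes values in `𝔤ᶜ = 𝔸` (for `G = U(N)` the printed `π` is the identity of `M_N(ℂ)`).
[cite: Balaban1987RG1, (1.8) p.261] -/
theorem unitaryModel_hπ (π : 𝔸 →ₗ[ℂ] 𝔸) : ∀ X, π X ∈ (unitaryModel 𝔸).gc := fun _ => mem_unitaryModel_gc _

end Unitary

/-! ## §2. The `SU(N)` model: the traceless projection `π` onto `𝔰𝔩(N, ℂ)` and the three hypotheses -/

section SpecialUnitary

/-- `M_N(ℂ)`. -/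
local notation "M[" N "]" => Matrix (Fin N) (Fin N) ℂ

attribute [local instance] B10Eq29TubeLine.cstarAlgebraMatrix

variable {N : ℕ}

variable (N) in
/-- **The projection `π` onto `𝔤ᶜ = 𝔰𝔩(N, ℂ)`** («π denotes the projection in the space of all complex N × N-matrices onto the algebra 𝔤ᶜ»,
here for `𝔤 = 𝔰𝔲(N)`): the traceless part `π X = X − (tr X / N)·1`, the projection along the scalars `ℂ·1`.
[cite: Balaban1987RG1, (1.8) p.261] -/
def slProj : M[N] →ₗ[ℂ] M[N] :=
  LinearMap.id - (Matrix.traceLinearMap (Fin N) ℂ ℂ).smulRight (((N : ℂ)⁻¹) • (1 : M[N]))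

/-- The formula `π X = X − (N⁻¹·tr X)·1`. [cite: Balaban1987RG1, (1.8) p.261] -/
theorem slProj_apply (X : M[N]) : slProj N X = X - ((N : ℂ)⁻¹ * X.trace) • (1 : M[N]) := by
  simp only [slProj, LinearMap.sub_apply, LinearMap.id_apply, LinearMap.smulRight_apply, Matrix.traceLinearMap_apply,
    smul_smul, mul_comm X.trace]

/-- **`π` takes values in `𝔰𝔩(N, ℂ)`**: `tr(π X) = 0`. [cite: Balaban1987RG1, (1.8) p.261] -/
theorem trace_slProj (X : M[N]) : (slProj N X).trace = 0 := by
  rw [slProj_apply, Matrix.trace_sub, Matrix.trace_smul, Matrix.trace_one, Fintype.card_fin, smul_eq_mul]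
  rcases Nat.eq_zero_or_pos N with hN | hN
  · subst hN
    simp [Matrix.trace]
  · have hN' : (N : ℂ) ≠ 0 := Nat.cast_ne_zero.2 hN.ne'
    field_simp
    ring

/-- **`π` is the identity on `𝔰𝔩(N, ℂ)`** (so `π` is a projection ONTO `𝔤ᶜ`). [cite: Balaban1987RG1, (1.8) p.261] -/
theorem slProj_of_trace_eq_zero {X : M[N]} (hX : X.trace = 0) : slProj N X = X := by
  rw [slProj_apply, hX, mul_zero, zero_smul, sub_zero]

/-- `π` is idempotent. [cite: Balaban1987RG1, (1.8) p.261] -/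
theorem slProj_slProj (X : M[N]) : slProj N (slProj N X) = slProj N X :=
  slProj_of_trace_eq_zero (trace_slProj X)

/-- **`π` commutes with the adjoint action of `GL(N, ℂ)`**: `π(gXg⁻¹) = g·π(X)·g⁻¹` (`tr(gXg⁻¹) = tr X`) — the hypothesis under which the
current (1.8) is gauge covariant (`B12Eq18Current.current_gaugeU`). [cite: Balaban1987RG1, (1.10) p.262] -/
theorem slProj_conj (g : (M[N])ˣ) (X : M[N]) :
    slProj N (B9Eq39Adjoint.R g X) = B9Eq39Adjoint.R g (slProj N X) := by
  have htr : ((g : M[N]) * X * ((g⁻¹ : (M[N])ˣ) : M[N])).trace = X.trace := by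
    rw [Matrix.trace_mul_cycle, Units.inv_mul, one_mul]
  simp only [B9Eq39Adjoint.R_def, slProj_apply, htr, mul_sub, sub_mul, Matrix.mul_smul, Matrix.smul_mul, mul_one,
    Units.mul_inv]

/-- `π X ∈ 𝔤ᶜ` in the `SU(N)` model. [cite: Balaban1987RG1, (1.8) p.261] -/
theorem slProj_mem_suModel_gc (X : M[N]) : slProj N X ∈ (suModel N).gc :=
  mem_suModel_gc.2 (trace_slProj X)

/-- **`heGc` in the `SU(N)` model**: `exp iξA ∈ SL(N, ℂ)` for `A ∈ 𝔰𝔩(N, ℂ)` (Liouville's formula `det e^{iξA} = e^{iξ tr A} = 1`;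
`B12RegularSpaces111SpecialUnitary.suModel_expI_mem_Gc`). [cite: Balaban1987RG1, p.252] -/
theorem suModel_heGc (ξ : ℝ) : ∀ A ∈ (suModel N).gc, expI ξ A ∈ (suModel N).Gc :=
  fun A hA => suModel_expI_mem_Gc ξ (E := fun _ : Unit => A) (fun _ => mem_suModel_gc.1 hA) ()

/-- **`hgc` in the `SU(N)` model**: `𝔰𝔩(N, ℂ)` is `Ad(SL(N, ℂ))`-stable (indeed `Ad(GL(N, ℂ))`-stable: `tr(gXg⁻¹) = tr X`).
[cite: Balaban1987RG1, (1.10) p.262] -/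
theorem suModel_hgc_Gc : ∀ g ∈ (suModel N).Gc, ∀ X ∈ (suModel N).gc, B9Eq39Adjoint.R g X ∈ (suModel N).gc := by
  intro g _ X hX
  rw [mem_suModel_gc] at hX ⊢
  rw [B9Eq39Adjoint.R_def, Matrix.trace_mul_cycle, Units.inv_mul, one_mul, hX]

end SpecialUnitary

/-! ## §3. Lemma 4 and the (1.17) specialisation for the printed pair `(𝐔, J(𝐔))`, model hypotheses discharged -/

section Corollaries

variable {P : Params} {i : ℕ}

/-- **Lemma 4, membership of the printed pair, `U(N)`-type model** (`G = U(𝔸)`, any `π`): `B12Lemma4Space.ofBackground_mem_space'_lemma4`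
with `heGc`, `hπ`, `hgc` and the `𝔤ᶜ`-valuedness of `𝐊`, `𝐀₂` discharged. [cite: Balaban1987RG1, Lemma 4 (3.53) p.280] -/
theorem ofBackground_mem_space'_lemma4_unitary {𝔸 : Type*} [NormedRing 𝔸] [NormedAlgebra ℂ 𝔸] [CompleteSpace 𝔸] [StarRing 𝔸]
    (c : B12Sec2to5.Lemma4Consts) (hR : B12Sec2to5.Lemma4Restrictions c)
    (hB : 1 ≤ c.B₃) (hY : 1 ≤ c.B₃ ^ 2 * c.O₁ * c.M) (hα₁ : 16 * (c.O₁ * c.M * c.α₁) ≤ c.β)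
    {F : Frame P i 𝔸} {cs : StepConsts} (hξ : 0 < cs.ξ) (hξ1 : cs.ξ ≤ 1) (hcB : 0 < cs.cB)
    {η τ n : ℝ} {j : ℕ} (hη : 0 ≤ η) (hj : 1 ≤ j) (hscale : c.L ^ j * η ≤ 1)
    (hξx : cs.ξ * (c.L ^ (j - 1) * η) = c.L⁻¹ * η) (hτ0 : 0 ≤ τ) (hτ1 : τ ≤ 1) (hn : n < c.α₃) (π : 𝔸 →ₗ[ℂ] 𝔸)
    {Y : Region P i} (hXb : F.X.bonds ⊆ Y.bonds) (hXd : F.X.dpairs ⊆ Y.dpairs)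
    (hXp : ∀ p ∈ F.X.plaqs, (⟨p.src, p.μ⟩ : PBond P i) ∈ Y.bonds ∧ (⟨p.src.shift p.μ, p.ν⟩ : PBond P i) ∈ Y.bonds ∧
      (⟨p.src.shift p.ν, p.μ⟩ : PBond P i) ∈ Y.bonds ∧ (⟨p.src, p.ν⟩ : PBond P i) ∈ Y.bonds ∧
      (p.src, p.μ, p.ν) ∈ Y.dpairs ∧ (p.src, p.ν, p.μ) ∈ Y.dpairs)
    {H K A : PBond P i → 𝔸} {ℓ : Plaq P i → 𝔸}
    (h41 : ∀ p ∈ F.X.plaqs, ‖((plaq (fun b => expI cs.ξ (H b)) p : 𝔸ˣ) : 𝔸) - 1‖ <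
      Real.exp (c.B₃ ^ 2 * c.O₁ * c.M * c.α₀) * Real.exp (c.B₃ * c.O₁ * c.M * c.α₀) *
      Real.exp (c.B₃ * c.O₁ * c.M * c.α₀) * Real.exp (c.O₁ * c.M * c.α₁) *
      ((1 + 2 * c.β) * c.α₀ * (c.L⁻¹ * η) ^ 2))
    (hH : ∀ b ∈ Y.bonds, ‖H b‖ < c.B₃ ^ 2 * c.O₁ * c.M * c.α₀ * (c.L ^ (j - 1) * η))
    (h45 : ∀ p ∈ F.X.plaqs, ‖(cs.ξ : ℂ)⁻¹ • (H ⟨p.src, p.μ⟩ + H ⟨p.src.shift p.μ, p.ν⟩ - H ⟨p.src.shift p.ν, p.μ⟩ -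
      H ⟨p.src, p.ν⟩) - ℓ p‖ < c.B₃ * (c.B₃ * c.O₁ * c.M * c.α₀ * (c.L ^ (j - 1) * η)) ^ 2)
    (hK : ∀ b ∈ Y.bonds, ‖K b‖ < c.B₃ ^ 2 * c.O₁ * c.M * c.α₀ * (c.L ^ (j - 1) * η))
    (hK1 : ∀ q ∈ Y.dpairs, ‖grad cs.ξ q.2.1 (fun y => K ⟨y, q.2.2⟩) q.1‖ < c.B₃ ^ 2 * c.O₁ * c.M * c.α₀ * (c.L ^ (j - 1) * η))
    (h45τ : ∀ p ∈ F.X.plaqs, ‖(cs.ξ : ℂ)⁻¹ • (K ⟨p.src, p.μ⟩ + K ⟨p.src.shift p.μ, p.ν⟩ - K ⟨p.src.shift p.ν, p.μ⟩ -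
      K ⟨p.src, p.ν⟩) - (τ : ℂ) • ℓ p‖ < c.B₃ * (c.B₃ * c.O₁ * c.M * c.α₀ * (c.L ^ (j - 1) * η)) ^ 2)
    (hA : ∀ b ∈ Y.bonds, ‖A b‖ ≤ c.B₃ * n)
    (hdA : ∀ q ∈ Y.dpairs, ‖grad cs.ξ q.2.1 (fun y => A ⟨y, q.2.2⟩) q.1‖ ≤ c.B₃ * n)
    (hJ : ∀ b ∈ F.X.bonds, ‖B12Eq18Current.current π cs.ξ (fun b => expI cs.ξ (K b + A b)) b‖ < c.α₀)
    (hIV : CondIV F.bg F.X₂ cs c.α₀ (fun b => expI cs.ξ (K b + A b))) (hIV₁ : CondIV F.bg F.X₂ cs c.α₀ (1 : PBond P i → 𝔸ˣ)) :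
    B12Eq18Current.ofBackground π cs.ξ (fun b => expI cs.ξ (K b + A b)) ∈ space' (unitaryModel 𝔸) F cs c.α₀ c.α₁ :=
  ofBackground_mem_space'_lemma4 (unitaryModel 𝔸) c hR hB hY hα₁ hξ hξ1 hcB hη hj hscale hξx hτ0 hτ1 hn (unitaryModel_heGc cs.ξ) π
    (unitaryModel_hπ π) unitaryModel_hgc_Gc hXb hXd hXp (fun _ => mem_unitaryModel_gc _) (fun _ => mem_unitaryModel_gc _) h41 hH h45
    hK hK1 h45τ hA hdA hJ hIV hIV₁

/-- `M_N(ℂ)`. -/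
local notation "M[" N "]" => Matrix (Fin N) (Fin N) ℂ

attribute [local instance] B10Eq29TubeLine.cstarAlgebraMatrix

/-- **Gauge covariance of the current (1.8) in the `SU(N)` model, hypothesis-free**: for EVERY `GL(N, ℂ)`-valued gauge
transformation `u`, `J(𝐔^u)(b) = R(u(b₋))J(𝐔)(b)` with `π = slProj N` (`B12Eq18Current.current_gaugeU` + `slProj_conj`).
[cite: Balaban1987RG1, (1.10) p.262] -/
theorem current_gaugeU_su {N : ℕ} (ξ : ℝ) (u : Site P i → (M[N])ˣ) (U : PBond P i → (M[N])ˣ) (b : PBond P i) :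
    B12Eq18Current.current (slProj N) ξ (gaugeU u U) b =
      B9Eq39Adjoint.R (u b.src) (B12Eq18Current.current (slProj N) ξ U b) :=
  B12Eq18Current.current_gaugeU (slProj N) ξ u (fun x X => slProj_conj (u x) X) U b

/-- **(1.9) intertwines (1.10) in the `SU(N)` model, hypothesis-free**: `(𝐔^u, J(𝐔^u)) = (𝐔, J(𝐔))^u` for every `GL(N, ℂ)`-valued `u`
(`B12Eq18Current.ofBackground_gaugeU` + `slProj_conj`). [cite: Balaban1987RG1, (1.10) p.262] -/
theorem ofBackground_gaugeU_su {N : ℕ} (ξ : ℝ) (u : Site P i → (M[N])ˣ) (U : PBond P i → (M[N])ˣ) :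
    B12Eq18Current.ofBackground (slProj N) ξ (gaugeU u U) = act u (B12Eq18Current.ofBackground (slProj N) ξ U) :=
  B12Eq18Current.ofBackground_gaugeU (slProj N) ξ u (fun x X => slProj_conj (u x) X) U

/-- **Lemma 4, membership of the printed pair, `SU(N)` model** (`G = SU(N)`, `Gᶜ = SL(N, ℂ)`, `𝔤ᶜ = 𝔰𝔩(N, ℂ)`, `π = slProj N`):
`B12Lemma4Space.ofBackground_mem_space'_lemma4` with `heGc`, `hπ`, `hgc` discharged; «𝔤ᶜ-valued» for `𝐊`, `𝐀₂` reads `tr = 0`.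
[cite: Balaban1987RG1, Lemma 4 (3.53) p.280] -/
theorem ofBackground_mem_space'_lemma4_su {N : ℕ} (c : B12Sec2to5.Lemma4Consts) (hR : B12Sec2to5.Lemma4Restrictions c)
    (hB : 1 ≤ c.B₃) (hY : 1 ≤ c.B₃ ^ 2 * c.O₁ * c.M) (hα₁ : 16 * (c.O₁ * c.M * c.α₁) ≤ c.β)
    {F : Frame P i M[N]} {cs : StepConsts} (hξ : 0 < cs.ξ) (hξ1 : cs.ξ ≤ 1) (hcB : 0 < cs.cB)
    {η τ n : ℝ} {j : ℕ} (hη : 0 ≤ η) (hj : 1 ≤ j) (hscale : c.L ^ j * η ≤ 1)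
    (hξx : cs.ξ * (c.L ^ (j - 1) * η) = c.L⁻¹ * η) (hτ0 : 0 ≤ τ) (hτ1 : τ ≤ 1) (hn : n < c.α₃)
    {Y : Region P i} (hXb : F.X.bonds ⊆ Y.bonds) (hXd : F.X.dpairs ⊆ Y.dpairs)
    (hXp : ∀ p ∈ F.X.plaqs, (⟨p.src, p.μ⟩ : PBond P i) ∈ Y.bonds ∧ (⟨p.src.shift p.μ, p.ν⟩ : PBond P i) ∈ Y.bonds ∧
      (⟨p.src.shift p.ν, p.μ⟩ : PBond P i) ∈ Y.bonds ∧ (⟨p.src, p.ν⟩ : PBond P i) ∈ Y.bonds ∧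
      (p.src, p.μ, p.ν) ∈ Y.dpairs ∧ (p.src, p.ν, p.μ) ∈ Y.dpairs)
    {H K A : PBond P i → M[N]} {ℓ : Plaq P i → M[N]} (hKtr : ∀ b, (K b).trace = 0) (hAtr : ∀ b, (A b).trace = 0)
    (h41 : ∀ p ∈ F.X.plaqs, ‖((plaq (fun b => expI cs.ξ (H b)) p : (M[N])ˣ) : M[N]) - 1‖ <
      Real.exp (c.B₃ ^ 2 * c.O₁ * c.M * c.α₀) * Real.exp (c.B₃ * c.O₁ * c.M * c.α₀) *
      Real.exp (c.B₃ * c.O₁ * c.M * c.α₀) * Real.exp (c.O₁ * c.M * c.α₁) *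
      ((1 + 2 * c.β) * c.α₀ * (c.L⁻¹ * η) ^ 2))
    (hH : ∀ b ∈ Y.bonds, ‖H b‖ < c.B₃ ^ 2 * c.O₁ * c.M * c.α₀ * (c.L ^ (j - 1) * η))
    (h45 : ∀ p ∈ F.X.plaqs, ‖(cs.ξ : ℂ)⁻¹ • (H ⟨p.src, p.μ⟩ + H ⟨p.src.shift p.μ, p.ν⟩ - H ⟨p.src.shift p.ν, p.μ⟩ -
      H ⟨p.src, p.ν⟩) - ℓ p‖ < c.B₃ * (c.B₃ * c.O₁ * c.M * c.α₀ * (c.L ^ (j - 1) * η)) ^ 2)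
    (hK : ∀ b ∈ Y.bonds, ‖K b‖ < c.B₃ ^ 2 * c.O₁ * c.M * c.α₀ * (c.L ^ (j - 1) * η))
    (hK1 : ∀ q ∈ Y.dpairs, ‖grad cs.ξ q.2.1 (fun y => K ⟨y, q.2.2⟩) q.1‖ < c.B₃ ^ 2 * c.O₁ * c.M * c.α₀ * (c.L ^ (j - 1) * η))
    (h45τ : ∀ p ∈ F.X.plaqs, ‖(cs.ξ : ℂ)⁻¹ • (K ⟨p.src, p.μ⟩ + K ⟨p.src.shift p.μ, p.ν⟩ - K ⟨p.src.shift p.ν, p.μ⟩ -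
      K ⟨p.src, p.ν⟩) - (τ : ℂ) • ℓ p‖ < c.B₃ * (c.B₃ * c.O₁ * c.M * c.α₀ * (c.L ^ (j - 1) * η)) ^ 2)
    (hA : ∀ b ∈ Y.bonds, ‖A b‖ ≤ c.B₃ * n)
    (hdA : ∀ q ∈ Y.dpairs, ‖grad cs.ξ q.2.1 (fun y => A ⟨y, q.2.2⟩) q.1‖ ≤ c.B₃ * n)
    (hJ : ∀ b ∈ F.X.bonds, ‖B12Eq18Current.current (slProj N) cs.ξ (fun b => expI cs.ξ (K b + A b)) b‖ < c.α₀)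
    (hIV : CondIV F.bg F.X₂ cs c.α₀ (fun b => expI cs.ξ (K b + A b)))
    (hIV₁ : CondIV F.bg F.X₂ cs c.α₀ (1 : PBond P i → (M[N])ˣ)) :
    B12Eq18Current.ofBackground (slProj N) cs.ξ (fun b => expI cs.ξ (K b + A b)) ∈ space' (suModel N) F cs c.α₀ c.α₁ :=
  ofBackground_mem_space'_lemma4 (suModel N) c hR hB hY hα₁ hξ hξ1 hcB hη hj hscale hξx hτ0 hτ1 hn (suModel_heGc cs.ξ) (slProj N)
    slProj_mem_suModel_gc suModel_hgc_Gc hXb hXd hXp (fun b => mem_suModel_gc.2 (hKtr b)) (fun b => mem_suModel_gc.2 (hAtr b))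
    h41 hH h45 hK hK1 h45τ hA hdA hJ hIV hIV₁

/-- **Lemma 4 in the letters of (3.37)/(3.53), `SU(N)` model**: print's configuration is `U_j(□₀, ·) = (exp iξ𝐇_j(□₀, ·))^{u_j}`
((3.37)), a gauge transform of `exp iξ𝐊`; with the current's covariance `(𝐔^u, J(𝐔^u)) = (𝐔, J(𝐔))^u` (`ofBackground_gaugeU_su`) and the
gauge invariance of the space («by the definition», `B12RegularSpaces111.act_mem_space`), the pair `((exp iξ𝐊)^{u}, J((exp iξ𝐊)^{u}))`
lies in `U^c_j(X, α₀, α₁)` for every `SL(N, ℂ)`-valued `u` under the hypotheses of `ofBackground_mem_space'_lemma4_su`.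
[cite: Balaban1987RG1, Lemma 4 (3.53) p.280 with (3.37) p.277] -/
theorem gaugeU_ofBackground_mem_space'_lemma4_su {N : ℕ} (c : B12Sec2to5.Lemma4Consts) (hR : B12Sec2to5.Lemma4Restrictions c)
    (hB : 1 ≤ c.B₃) (hY : 1 ≤ c.B₃ ^ 2 * c.O₁ * c.M) (hα₁ : 16 * (c.O₁ * c.M * c.α₁) ≤ c.β)
    {F : Frame P i M[N]} {cs : StepConsts} (hξ : 0 < cs.ξ) (hξ1 : cs.ξ ≤ 1) (hcB : 0 < cs.cB)
    {η τ n : ℝ} {j : ℕ} (hη : 0 ≤ η) (hj : 1 ≤ j) (hscale : c.L ^ j * η ≤ 1)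
    (hξx : cs.ξ * (c.L ^ (j - 1) * η) = c.L⁻¹ * η) (hτ0 : 0 ≤ τ) (hτ1 : τ ≤ 1) (hn : n < c.α₃)
    {Y : Region P i} (hXb : F.X.bonds ⊆ Y.bonds) (hXd : F.X.dpairs ⊆ Y.dpairs)
    (hXp : ∀ p ∈ F.X.plaqs, (⟨p.src, p.μ⟩ : PBond P i) ∈ Y.bonds ∧ (⟨p.src.shift p.μ, p.ν⟩ : PBond P i) ∈ Y.bonds ∧
      (⟨p.src.shift p.ν, p.μ⟩ : PBond P i) ∈ Y.bonds ∧ (⟨p.src, p.ν⟩ : PBond P i) ∈ Y.bonds ∧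
      (p.src, p.μ, p.ν) ∈ Y.dpairs ∧ (p.src, p.ν, p.μ) ∈ Y.dpairs)
    {H K A : PBond P i → M[N]} {ℓ : Plaq P i → M[N]} (hKtr : ∀ b, (K b).trace = 0) (hAtr : ∀ b, (A b).trace = 0)
    (h41 : ∀ p ∈ F.X.plaqs, ‖((plaq (fun b => expI cs.ξ (H b)) p : (M[N])ˣ) : M[N]) - 1‖ <
      Real.exp (c.B₃ ^ 2 * c.O₁ * c.M * c.α₀) * Real.exp (c.B₃ * c.O₁ * c.M * c.α₀) *
      Real.exp (c.B₃ * c.O₁ * c.M * c.α₀) * Real.exp (c.O₁ * c.M * c.α₁) *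
      ((1 + 2 * c.β) * c.α₀ * (c.L⁻¹ * η) ^ 2))
    (hH : ∀ b ∈ Y.bonds, ‖H b‖ < c.B₃ ^ 2 * c.O₁ * c.M * c.α₀ * (c.L ^ (j - 1) * η))
    (h45 : ∀ p ∈ F.X.plaqs, ‖(cs.ξ : ℂ)⁻¹ • (H ⟨p.src, p.μ⟩ + H ⟨p.src.shift p.μ, p.ν⟩ - H ⟨p.src.shift p.ν, p.μ⟩ -
      H ⟨p.src, p.ν⟩) - ℓ p‖ < c.B₃ * (c.B₃ * c.O₁ * c.M * c.α₀ * (c.L ^ (j - 1) * η)) ^ 2)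
    (hK : ∀ b ∈ Y.bonds, ‖K b‖ < c.B₃ ^ 2 * c.O₁ * c.M * c.α₀ * (c.L ^ (j - 1) * η))
    (hK1 : ∀ q ∈ Y.dpairs, ‖grad cs.ξ q.2.1 (fun y => K ⟨y, q.2.2⟩) q.1‖ < c.B₃ ^ 2 * c.O₁ * c.M * c.α₀ * (c.L ^ (j - 1) * η))
    (h45τ : ∀ p ∈ F.X.plaqs, ‖(cs.ξ : ℂ)⁻¹ • (K ⟨p.src, p.μ⟩ + K ⟨p.src.shift p.μ, p.ν⟩ - K ⟨p.src.shift p.ν, p.μ⟩ -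
      K ⟨p.src, p.ν⟩) - (τ : ℂ) • ℓ p‖ < c.B₃ * (c.B₃ * c.O₁ * c.M * c.α₀ * (c.L ^ (j - 1) * η)) ^ 2)
    (hA : ∀ b ∈ Y.bonds, ‖A b‖ ≤ c.B₃ * n)
    (hdA : ∀ q ∈ Y.dpairs, ‖grad cs.ξ q.2.1 (fun y => A ⟨y, q.2.2⟩) q.1‖ ≤ c.B₃ * n)
    (hJ : ∀ b ∈ F.X.bonds, ‖B12Eq18Current.current (slProj N) cs.ξ (fun b => expI cs.ξ (K b + A b)) b‖ < c.α₀)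
    (hIV : CondIV F.bg F.X₂ cs c.α₀ (fun b => expI cs.ξ (K b + A b)))
    (hIV₁ : CondIV F.bg F.X₂ cs c.α₀ (1 : PBond P i → (M[N])ˣ)) (u : Site P i → (M[N])ˣ)
    (hu : ∀ x, Matrix.det (u x : M[N]) = 1) :
    B12Eq18Current.ofBackground (slProj N) cs.ξ (gaugeU u fun b => expI cs.ξ (K b + A b)) ∈
      space' (suModel N) F cs c.α₀ c.α₁ := by
  rw [ofBackground_gaugeU_su]
  exact act_mem_space (ofBackground_mem_space'_lemma4_su c hR hB hY hα₁ hξ hξ1 hcB hη hj hscale hξx hτ0 hτ1 hn hXb hXd hXp hKtr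
    hAtr h41 hH h45 hK hK1 h45τ hA hdA hJ hIV hIV₁) (fun x => mem_suModel_Gc.2 (hu x))

/-- **The (1.17) specialisation `(𝐔, 𝐉 = D^{ξ*}_𝐔ξ⁻²π Im ∂𝐔)`, `U(N)`-type model** (any `π`): `B12Eq117Concrete.ofBackground_mem_space'_of_prop9Shape`
with `hπ`, `hgc` and the `Gᶜ`-valuedness of `𝐔` discharged. [cite: Balaban1987RG1, (1.17) p.263] -/
theorem ofBackground_mem_space'_of_prop9Shape_unitary {𝔸 : Type*} [NormedRing 𝔸] [NormedAlgebra ℂ 𝔸] [CompleteSpace 𝔸]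
    [StarRing 𝔸] {F : Frame P i 𝔸} {c : StepConsts} (hcB : 0 ≤ c.cB) (hL : c.L ≠ 0)
    {B₃ α₀' α₁' α₀ α₁ : ℝ} (h₀ : α₀' ≤ α₀) (h₁ : α₁' ≤ α₁) (hsmall : 2 * B₃ * α₀' ≤ α₀)
    (h117 : ∀ V : PBond P i → 𝔸ˣ, (∀ p ∈ F.X.plaqs, ‖(↑(plaq V p) : 𝔸) - 1‖ < α₀' * c.ξ ^ 2) → ∀ n, 1 ≤ n → n ≤ c.j →
      (∀ p ∈ F.X₂.plaqs, ‖(↑(plaq (F.bg.Un n V) p) : 𝔸) - 1‖ < B₃ * (2 * α₀') * (c.L ^ n)⁻¹ ^ 2 * (c.L ^ n * c.ξ) ^ 2) ∧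
      (∀ b ∈ F.X₂.bonds, ‖F.bg.Jn n V b‖ < B₃ * (2 * α₀') * (c.L ^ n * c.ξ) ^ 2))
    (π : 𝔸 →ₗ[ℂ] 𝔸) {Uc U : PBond P i → 𝔸ˣ} {A' : PBond P i → 𝔸} (hf : Factors c Uc U A')
    (hI : CondI (unitaryModel 𝔸) F c α₀' U) (hII : CondII (unitaryModel 𝔸) F.X c α₁' U A')
    (hplaq : ∀ p ∈ F.X.plaqs, ‖(↑(plaq Uc p) : 𝔸) - 1‖ < α₀' * c.ξ ^ 2)
    (hJ : ∀ b ∈ F.X.bonds, ‖B12Eq18Current.current π c.ξ Uc b‖ < α₀') :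
    B12Eq18Current.ofBackground π c.ξ Uc ∈ space' (unitaryModel 𝔸) F c α₀ α₁ :=
  ofBackground_mem_space'_of_prop9Shape (unitaryModel 𝔸) hcB hL h₀ h₁ hsmall h117 π (unitaryModel_hπ π) unitaryModel_hgc_Gc
    (fun _ => mem_unitaryModel_Gc _) hf hI hII hplaq hJ

/-- **The (1.17) specialisation, `SU(N)` model** (`π = slProj N`; «Gᶜ-valued» for `𝐔` reads `det 𝐔(b) = 1`):
`B12Eq117Concrete.ofBackground_mem_space'_of_prop9Shape` with `hπ`, `hgc` discharged. [cite: Balaban1987RG1, (1.17) p.263] -/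
theorem ofBackground_mem_space'_of_prop9Shape_su {N : ℕ} {F : Frame P i M[N]} {c : StepConsts} (hcB : 0 ≤ c.cB) (hL : c.L ≠ 0)
    {B₃ α₀' α₁' α₀ α₁ : ℝ} (h₀ : α₀' ≤ α₀) (h₁ : α₁' ≤ α₁) (hsmall : 2 * B₃ * α₀' ≤ α₀)
    (h117 : ∀ V : PBond P i → (M[N])ˣ, (∀ p ∈ F.X.plaqs, ‖(↑(plaq V p) : M[N]) - 1‖ < α₀' * c.ξ ^ 2) → ∀ n, 1 ≤ n → n ≤ c.j →
      (∀ p ∈ F.X₂.plaqs, ‖(↑(plaq (F.bg.Un n V) p) : M[N]) - 1‖ < B₃ * (2 * α₀') * (c.L ^ n)⁻¹ ^ 2 * (c.L ^ n * c.ξ) ^ 2) ∧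
      (∀ b ∈ F.X₂.bonds, ‖F.bg.Jn n V b‖ < B₃ * (2 * α₀') * (c.L ^ n * c.ξ) ^ 2))
    {Uc U : PBond P i → (M[N])ˣ} {A' : PBond P i → M[N]} (hUc : ∀ b, Matrix.det (Uc b : M[N]) = 1) (hf : Factors c Uc U A')
    (hI : CondI (suModel N) F c α₀' U) (hII : CondII (suModel N) F.X c α₁' U A')
    (hplaq : ∀ p ∈ F.X.plaqs, ‖(↑(plaq Uc p) : M[N]) - 1‖ < α₀' * c.ξ ^ 2)
    (hJ : ∀ b ∈ F.X.bonds, ‖B12Eq18Current.current (slProj N) c.ξ Uc b‖ < α₀') :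
    B12Eq18Current.ofBackground (slProj N) c.ξ Uc ∈ space' (suModel N) F c α₀ α₁ :=
  ofBackground_mem_space'_of_prop9Shape (suModel N) hcB hL h₀ h₁ hsmall h117 (slProj N) slProj_mem_suModel_gc suModel_hgc_Gc
    (fun b => mem_suModel_Gc.2 (hUc b)) hf hI hII hplaq hJ

end Corollaries

end

end Literature.MathematicalPhysics.QuantumFieldTheory.Balaban1983to89.B12Lemma4Models
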